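import Summits.BirchSwinnertonDyer.BirchSwinnertonDyer.Theses.SignedLowerHalves
import Summits.BirchSwinnertonDyer.BirchSwinnertonDyer.Theorems.SprungSharpFlatMainConjecture
import Summits.BirchSwinnertonDyer.Rank1Residual.Supersingular.SprungConstantTerm
import Literature.NumberTheory.EllipticCurves.Sprung2024.ChromaticSmallControl
import Literature.NumberTheory.EllipticCurves.Sprung2024.ChromaticCharValueRankZeroAllN
import Literature.NumberTheory.EllipticCurves.IwasawaEulerCharRankZeroProofs
import Literature.NumberTheory.EllipticCurves.Sprung2012.SharpFlatSelmerDualExistsProofs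
import Literature.NumberTheory.EllipticCurves.Sprung2012.SharpFlatKatoDivisibility
import Literature.NumberTheory.EllipticCurves.Sprung2012.ColemanMapTheorems
import Literature.NumberTheory.EllipticCurves.Sprung2017.SharpFlatNonvanishingProofs
import Literature.NumberTheory.EllipticCurves.Sprung2017.SharpFlatPAdicLFunctionProofs
import Literature.NumberTheory.EllipticCurves.CyclotomicZpExtensionLocalGeneratorProofs
import Literature.NumberTheory.EllipticCurves.LeadingTermPPartProofs
import Literature.NumberTheory.EllipticCurves.ModularCurveNeronLatticeProofs
import Literature.NumberTheory.EllipticCurves.ModularParametrizationDegreeHoldsProofs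
import Literature.NumberTheory.EllipticCurves.ModularCurveManinSemistableLatticeFormProofs
import Literature.NumberTheory.EllipticCurves.ModularParametrizationBCDTProofs
import HarnessLib

/-!
# Route `SignedLowerHalves`, crux 5 `SprungLowerHalfAtThree` — the split's second crux child
# K2 `SharpFlatRankZeroConverseAtThree` ((conv₀) on X8, item stmt-BirchSwinnertonDyer-19877)
# FOLLOWS FROM the first, K1 `SprungLowerDivisibilityAtThree` ((MC↓•) by name), modulo the small
# control theorem (Sprung 2024 Lemma 5.6, W-KDOT-CTRL) and the split's held published inputs S4
# (cell `bsd-ssimc`, seat `bsd-ssimc-k3c5-kdot-split` g4; `--supports … --as helper`, closes nothing)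

PARTITION (cell bsd-ssimc): X8 (A8) — `p = 3` good supersingular, `a_3 = ±3` — all conductors,
Selmer corank `0`; proves-the-reduction-of (K2 ⟸ K1); closes NONE (K2 stays an open crux; it closes
only if the tenure planner re-glues the split with Lemma 5.6 as a held child); 0 census moves; BSD is
not proved by any of this.

## What this file proves

The tenure planner's want **W-KDOT-CTRL** (D24-11 (3), TARGET v12.6.12 l.7: "K2 (19877) WANTED = a
♯/♭ control theorem at finite level for `a_p ≠ 0` — the printed source or the honest «not in
print»") has a printed source: F. Ito Sprung, Adv. Math. **449** (2024) 109741, §5.2 **Lemma 5.6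
(Small Control Theorem)**, p. 41 (= arXiv:1610.10017 Lemma 4.7): "The natural morphism
`X⋆/XX⋆ ⟶ X⋆_0/XX⋆_0 = X_0` is surjective and has finite kernel" (`X_0 = Hom(Sel(E,ℚ), ℚ_p/ℤ_p)`;
proof = Kobayashi's Thm. 9.3 at `n = 0` plus `r_p` injective, Lemma 5.5), typed by this seat as the
named facts `Sprung2024.lem56_sharpFlat_finite_coinvariants_of_finite_selmer` (§5.2's standing
square-free binder verbatim) / `Sprung2024.lem56AllN_…` (all conductors, flag
`Sprung24-§5.2-L5.6-allN-via-RaySprung25`) in `Literature/…/Sprung2024/ChromaticSmallControl.lean`, in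
the corollary form the printed proof of Lemma 5.7 consumes: `Sel_{p^∞}(E/ℚ)` finite ⟹
`X⋆/XX⋆ = IwasawaAlgebra.coinvariants p D.X` finite.

With it, **the rank-`0` `p`-converse at `(3, a_3 = ±3)` is the Eisenstein half of the ♯/♭ main
conjecture, BY NAME** — Greenberg's argument (LNM 1716 §4, p. 102: "`X_E(F_∞)/TX_E(F_∞)` is finite.
Hence `T ∤ f_E(T)` and so `f_E(0) ≠ 0`") run on Sprung's real `X^•(E/ℚ_∞)`:

* `sharpFlatRankZeroConverseAtThree_of_sprungLowerDivisibility :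
    lem56AllN → SharpFlatPublishedInputsAtThree → SprungLowerDivisibilityAtThree →
    SharpFlatRankZeroConverseAtThree`.
  Proof. Fix an X8 pair `(W, 3)` with `Sel_{3^∞}(E/ℚ)` finite. S4(M) gives a newform `f`; the
  period ratio `ϖ > 0` with `ϖ·Ω_W = Ω⁺_f` is unconditional (`exists_pos_periodRatio_of_isNewformOf'`,
  BCDT + Edixhoven, tree theorems) and a Sprung pair `(L♯, L♭)` exists
  (`Sprung2017.thm112_exists_isSprungPair_holds`, PROVED). Cyclotomic `(κ, γ)`, the place `v ∋ 3`,
  the local lift `g` (p473737) are tree objects; S4(H) gives a Honda system `(c₋, c)`. By Sprung 2012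
  Prop. 6.14 (first sentence; Rohrlich — tree theorem `IsSprungPair.exists_chromaticL_ne_zero`) some
  colour `•` has `L^• ≠ 0`. Let `D := Sprung2012.sharpFlatSelmerDualData …` be the real `X^•`
  (p470048). K1 (MC↓•) gives `char_Λ(D.X) = (gen)` with `ι gen = ϖ · ι(L^• · h)`; S4(T) (Sprung 2012
  Thm. 7.14) makes `D.X` finitely generated torsion; Lemma 5.6 makes `D.X/T·D.X` finite; Greenberg's
  Lemma 4.2 (tree theorem `IwasawaAlgebra.constantCoeff_charGenerator_ne_zero_of_finite_coinvariants`)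
  gives `gen(0) ≠ 0`, hence `ϖ · L^•(0) · h(0) ≠ 0`, hence `L^•(0) ≠ 0`; Sprung's table of special
  values (P•) (`constantCoeff_chromaticL_of_isSprungPair_of_isNewformOf`: `L^•(0) = c_• · [0]⁺_f`)
  gives `[0]⁺_f ≠ 0`, and `L(E,1) = [0]⁺_f · Ω⁺_f` (`IsNewformOf.entireLFunction_one_eq`, `Ω⁺_f > 0`)
  gives `L(E,1) ≠ 0`. ∎
* `…_semistable_of_sprungLowerDivisibility` — the same on X8 ∩ {square-free `N`} from the printed
  form `lem56_…` (no flag);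
* the faithfulness edge `lem56_sharpFlat_finite_coinvariants_of_finite_selmer_of_allN` (allN ⟹
  printed form; kept out of the statements-only Literature file).
The compositions with the glue (crux 5 ⟸ K1 ∧ K3 ∧ S4 ∧ Lemma 5.6, p482444) and with the edges of S4
(p482847) live in the sibling `…SplitConverseGlue.lean`, so that THIS file builds on no Theorems
module that imports the route file (theses-cone hygiene).

HONEST STATUS: CONDITIONAL on K1 (OPEN conjecture: the Eisenstein half of Sprung 2012 Main Conj.
7.21 at `(3, ±3)`) and on the named facts Lemma 5.6 (allN form flagged), Sprung 2012 Thm. 2.2 / 7.14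
and modularity (through S4); closes nothing; 0 cells move. What it changes: the split of crux 5 has
ONE open mathematical child (K1), not two.

References: [Sprung2024] §5.2 Lemma 5.6, Lemma 5.7 (p. 41); [GreenbergLNM1716] §4 p. 102 and
Lemma 4.2; [Sprung2012] Thm. 2.2, Prop. 6.14, Thm. 7.14, Main Conj. 7.21; [Sprung2017] Thm. 1.12,
Cor. 4.11; [Kobayashi2003] Thm. 9.3; [RaySprung2025] p. 2343; [BCDTJAMS2001] Thm. A;
[MazurTateTeitelbaum1986Invent] §I.8.
-/

set_option autoImplicit false
-- justification: the mandated namespace `Summit.BirchSwinnertonDyer.BirchSwinnertonDyer.Theorems`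
-- (single-conjunct summit, Sub = Summit) repeats a segment by design (D-0017).
set_option linter.dupNamespace false

noncomputable section

namespace Summit.BirchSwinnertonDyer.BirchSwinnertonDyer.Theorems.SprungLowerHalfAtThreeSplit

open scoped Classical NumberField MatrixGroups ModularForm
open NumberField IsDedekindDomain WeierstrassCurve CongruenceSubgroup
  Literature.NumberTheory.EllipticCurves Literature.NumberTheory.EllipticCurves.ModularForms
  Literature.NumberTheory.EllipticCurves.Rank1Residual
  Literature.NumberTheory.EllipticCurves.Sprung2017 Literature.NumberTheory.EllipticCurves.Sprung2012
  Literature.NumberTheory.EllipticCurves.Sprung2024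
  Literature.NumberTheory.EllipticCurves.ZpExtension
  Summit.BirchSwinnertonDyer.Rank1Residual.Supersingular
  Summit.BirchSwinnertonDyer.BirchSwinnertonDyer.Theses.SignedLowerHalves

/-! ### The period ratio of a newform of `W` (route-independent re-run) -/

/-- `Ω⁺_f = ϖ · Ω(W)` with `ϖ ∈ ℚ_{>0}` for every newform `f` of an elliptic `W/ℚ` — the argument of
`Theorems.exists_pos_periodRatio_of_isNewformOf` (file `…SprungPairOfModularity.lean`), re-run from its
Literature inputs (a Néron-type period pair `exists_isNeronLatticeOf_holds`, a non-zero Manin-type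
constant `IsNewformOf.exists_maninConstant_ne_zero_holds`, the parametrisation datum
`ModularParametrizationData.exists_of_isNewformOf` and Edixhoven's period relation
`exists_rat_mul_realPeriodRat_eq_plusPeriod`) so that this module does not build on a route-importing
Theorems module. Unconditional. [cite: BCDTJAMS2001, p. 845 (2) ⇒ (6)] [cite: EdixhovenManin1991, §1] -/
theorem exists_pos_periodRatio_of_isNewformOf' (W : WeierstrassCurve ℚ) [W.IsElliptic] {N : ℕ}
    [NeZero N] (f : CuspForm (Gamma0 N) 2) (hf : IsNewformOf W f) :
    ∃ ϖ : ℚ, 0 < ϖ ∧ (ϖ : ℝ) * W.realPeriodRat = plusPeriod f := by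
  haveI : (W.baseChange ℂ).IsElliptic := by rw [WeierstrassCurve.baseChange]; infer_instance
  obtain ⟨L, hL⟩ := exists_isNeronLatticeOf_holds (W.baseChange ℂ)
  obtain ⟨c, hc0, hc⟩ := IsNewformOf.exists_maninConstant_ne_zero_holds hf hL
  obtain ⟨D, hDf, -, -⟩ := ModularParametrizationData.exists_of_isNewformOf hf hL hc0 hc
  obtain ⟨ϖ, hϖpos, hϖ, -⟩ := D.exists_rat_mul_realPeriodRat_eq_plusPeriod
  exact ⟨ϖ, hϖpos, by rw [hϖ, hDf]⟩

/-! ### K2 ⟸ K1: the rank-0 `p`-converse on X8 from the Eisenstein half of the ♯/♭ main conjecture -/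

/-- **(conv₀) ⟸ (MC↓•) on class X8, BY NAME.** Granted Sprung 2024 Lemma 5.6 in its all-conductor
corollary form (`hctrl`, named fact, flag `Sprung24-§5.2-L5.6-allN-via-RaySprung25`) and the split's
held published inputs S4 (`hS4`: newform on X8, Sprung 2012 Thm. 2.2 Honda system, Thm. 7.14
`Λ`-torsion), the crux child K1 `SprungLowerDivisibilityAtThree` implies the crux child K2
`SharpFlatRankZeroConverseAtThree`: for every X8 pair, `Sel_{3^∞}(E/ℚ)` finite ⟹ `L(E,1) ≠ 0`.
Proof (module docstring): Rohrlich colour `•` with `L^• ≠ 0`; `D :=` the real `X^•`; K1 ⇒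
`char(D.X) = (gen)`, `ι gen = ϖ·ι(L^•·h)`; S4(T) ⇒ torsion; Lemma 5.6 ⇒ `D.X/T·D.X` finite;
Greenberg's Lemma 4.2 ⇒ `gen(0) ≠ 0` ⇒ `L^•(0) ≠ 0` ⇒ (P•) `[0]⁺_f ≠ 0` ⇒ `L(E,1) = [0]⁺_f·Ω⁺_f ≠ 0`.
CONDITIONAL on K1 (OPEN) and the two named inputs; closes nothing.
[cite: Sprung2024, §5.2 Lemma 5.6 and Lemma 5.7 (p. 41)] [cite: GreenbergLNM1716, §4 p. 102 and Lemma 4.2]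
[cite: Sprung2012, Prop. 6.14, Thm. 7.14 and Main Conj. 7.21] [cite: Sprung2017, Cor. 4.11] -/
theorem sharpFlatRankZeroConverseAtThree_of_sprungLowerDivisibility
    (hctrl : lem56AllN_sharpFlat_finite_coinvariants_of_finite_selmer)
    (hS4 : SharpFlatPublishedInputsAtThree) (hK1 : SprungLowerDivisibilityAtThree) :
    SharpFlatRankZeroConverseAtThree := by
  unfold SharpFlatRankZeroConverseAtThree
  intro W _ _ p _ hX hfin
  obtain ⟨⟨N, hN, f, hf⟩, hS4'⟩ := hS4 W p hX
  haveI := hN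
  have hp3 : p = 3 := hX.1
  subst hp3
  have hp2 : (3 : ℕ) ≠ 2 := by decide
  have hgood : W.HasGoodReductionAtPrime 3 := hX.2.1.1
  have hdvd : ((3 : ℕ) : ℤ) ∣ W.frobeniusTrace 3 := hX.2.1.2
  -- the real objects of clause (A): period ratio and a Sprung pair for the newform `f`
  obtain ⟨ϖ, -, hϖ⟩ := exists_pos_periodRatio_of_isNewformOf' W f hf
  obtain ⟨Lsharp, Lflat, hSP⟩ :=
    thm112_exists_isSprungPair_holds (W := W) (f := f) (p := 3) (by decide) hf hgood hdvd
  -- the cyclotomic setting, the place above `3`, a local lift of `γ`, a Honda system (S4(H))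
  obtain ⟨κ, hκ, γ, hγ, hγ'⟩ := exists_isCyclotomic_isTopGenerator_isCyclotomicVariable_holds 3
  obtain ⟨v, hv⟩ :=
    Literature.NumberTheory.NumberFields.RingOfIntegers.exists_heightOneSpectrum_natCast_mem ℚ
      (p := 3) (by norm_num)
  obtain ⟨g, hg⟩ := hκ.exists_isTopGenerator_resGalOfEmb_adicCompletion v hv
  obtain ⟨⟨cneg, c, hc⟩, h714⟩ := hS4' κ γ hκ hγ hγ' v hv g hg
  -- the Rohrlich colour: `L^• ≠ 0` (Sprung 2012 Prop. 6.14, first sentence; tree theorem)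
  obtain ⟨col, hcol⟩ := hSP.exists_chromaticL_ne_zero hf hgood
  -- Sprung's real `X^•(E/ℚ_∞)` (p470048)
  let D := sharpFlatSelmerDualData W κ (closureEmb (K := ℚ) (v.adicCompletion ℚ))
    (W.frobeniusTrace 3) g c col hγ
  -- (MC↓•) by name: a generator of `char_Λ(X^•)` divisible by `ϖ · L^•`
  obtain ⟨gen, h, hchar, hι⟩ :=
    hK1 W 3 hX col κ γ hκ hγ hγ' v hv g hg cneg c hc N hN f ϖ Lsharp Lflat hf hϖ hSP hcol D
  -- cotorsion (S4(T) = Sprung 2012 Thm. 7.14) and small control (Sprung 2024 Lemma 5.6)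
  obtain ⟨hfinD, htorD⟩ := h714 cneg c hc N hN f hf col Lsharp Lflat hSP hcol D
  haveI := hfinD
  have hco : Finite (IwasawaAlgebra.coinvariants 3 D.X) :=
    hctrl W 3 hp2 hgood hdvd κ γ hκ hγ hγ' v hv g hg cneg c hc col D hfin
  -- Greenberg's Lemma 4.2 (tree): `X^•/TX^•` finite ⇒ `gen(0) ≠ 0`
  have hgen0 : PowerSeries.constantCoeff gen ≠ 0 :=
    IwasawaAlgebra.constantCoeff_charGenerator_ne_zero_of_finite_coinvariants 3 D.X htorD gen hchar hco
  -- constant terms of `ι gen = ϖ · ι(L^• · h)`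
  have hι0 := congrArg PowerSeries.constantCoeff hι
  rw [map_mul, PowerSeries.constantCoeff_C, constantCoeff_iwasawaToPowerSeries,
    constantCoeff_iwasawaToPowerSeries, map_mul, PadicInt.coe_mul] at hι0
  have hL0 : ((PowerSeries.constantCoeff (chromaticL col Lsharp Lflat) : ℤ_[3]) : ℚ_[3]) ≠ 0 := by
    intro h0
    apply hgen0
    have h1 : ((PowerSeries.constantCoeff gen : ℤ_[3]) : ℚ_[3]) = 0 := by
      rw [hι0, h0, zero_mul, mul_zero]
    exact PadicInt.coe_eq_zero.mp h1
  -- Sprung's table of special values (P•): `L^•(0) = c_• · [0]⁺_f`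
  have hP := constantCoeff_chromaticL_of_isSprungPair_of_isNewformOf hp2 hf hgood hSP col
  have hr : ratPlusSymbol f 0 ≠ 0 := by
    intro h0
    apply hL0
    rw [hP, h0, Rat.cast_zero, mul_zero]
  -- `L(E,1) = [0]⁺_f · Ω⁺_f ≠ 0`
  have hpos : 0 < plusPeriod f := IsNewform0.plusPeriod_pos_holds hf.1 hf.coeffField_eq_bot
  rw [hf.entireLFunction_one_eq]
  exact_mod_cast mul_ne_zero (Rat.cast_ne_zero.mpr hr) hpos.ne'

/-- **(conv₀) ⟸ (MC↓•) on X8 ∩ {square-free `N`} from the PRINTED form of Lemma 5.6** (named fact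
`lem56_sharpFlat_finite_coinvariants_of_finite_selmer`, §5.2's standing binder `W.IsSemistable (𝓞 ℚ)`
kept; no flag): for every semistable X8 pair, granted S4 and K1, `Sel_{3^∞}(E/ℚ)` finite ⟹
`L(E,1) ≠ 0`. Same proof as `sharpFlatRankZeroConverseAtThree_of_sprungLowerDivisibility`, the
control step reading the semistable binder. CONDITIONAL on K1 (OPEN) and the named inputs; closes
nothing. [cite: Sprung2024, §5.2 Lemma 5.6 and Lemma 5.7 (p. 41)]
[cite: GreenbergLNM1716, §4 Lemma 4.2] [cite: Sprung2012, Prop. 6.14, Thm. 7.14 and Main Conj. 7.21] -/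
theorem sharpFlatRankZeroConverseAtThree_semistable_of_sprungLowerDivisibility
    (hctrl : lem56_sharpFlat_finite_coinvariants_of_finite_selmer)
    (hS4 : SharpFlatPublishedInputsAtThree) (hK1 : SprungLowerDivisibilityAtThree) :
    ∀ (W : WeierstrassCurve ℚ) [W.IsElliptic] [W.IsGloballyMinimal] (p : ℕ) [Fact p.Prime],
      ClassX8 W p → W.IsSemistable (𝓞 ℚ) → Finite (W.selmerGroupPInfty p) →
        W.entireLFunction 1 ≠ 0 := by
  intro W _ _ p _ hX hss hfin
  obtain ⟨⟨N, hN, f, hf⟩, hS4'⟩ := hS4 W p hX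
  haveI := hN
  have hp3 : p = 3 := hX.1
  subst hp3
  have hp2 : (3 : ℕ) ≠ 2 := by decide
  have hgood : W.HasGoodReductionAtPrime 3 := hX.2.1.1
  have hdvd : ((3 : ℕ) : ℤ) ∣ W.frobeniusTrace 3 := hX.2.1.2
  obtain ⟨ϖ, -, hϖ⟩ := exists_pos_periodRatio_of_isNewformOf' W f hf
  obtain ⟨Lsharp, Lflat, hSP⟩ :=
    thm112_exists_isSprungPair_holds (W := W) (f := f) (p := 3) (by decide) hf hgood hdvd
  obtain ⟨κ, hκ, γ, hγ, hγ'⟩ := exists_isCyclotomic_isTopGenerator_isCyclotomicVariable_holds 3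
  obtain ⟨v, hv⟩ :=
    Literature.NumberTheory.NumberFields.RingOfIntegers.exists_heightOneSpectrum_natCast_mem ℚ
      (p := 3) (by norm_num)
  obtain ⟨g, hg⟩ := hκ.exists_isTopGenerator_resGalOfEmb_adicCompletion v hv
  obtain ⟨⟨cneg, c, hc⟩, h714⟩ := hS4' κ γ hκ hγ hγ' v hv g hg
  obtain ⟨col, hcol⟩ := hSP.exists_chromaticL_ne_zero hf hgood
  let D := sharpFlatSelmerDualData W κ (closureEmb (K := ℚ) (v.adicCompletion ℚ))
    (W.frobeniusTrace 3) g c col hγ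
  obtain ⟨gen, h, hchar, hι⟩ :=
    hK1 W 3 hX col κ γ hκ hγ hγ' v hv g hg cneg c hc N hN f ϖ Lsharp Lflat hf hϖ hSP hcol D
  obtain ⟨hfinD, htorD⟩ := h714 cneg c hc N hN f hf col Lsharp Lflat hSP hcol D
  haveI := hfinD
  have hco : Finite (IwasawaAlgebra.coinvariants 3 D.X) :=
    hctrl W 3 hp2 hss hgood hdvd κ γ hκ hγ hγ' v hv g hg cneg c hc col D hfin
  have hgen0 : PowerSeries.constantCoeff gen ≠ 0 :=
    IwasawaAlgebra.constantCoeff_charGenerator_ne_zero_of_finite_coinvariants 3 D.X htorD gen hchar hco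
  have hι0 := congrArg PowerSeries.constantCoeff hι
  rw [map_mul, PowerSeries.constantCoeff_C, constantCoeff_iwasawaToPowerSeries,
    constantCoeff_iwasawaToPowerSeries, map_mul, PadicInt.coe_mul] at hι0
  have hL0 : ((PowerSeries.constantCoeff (chromaticL col Lsharp Lflat) : ℤ_[3]) : ℚ_[3]) ≠ 0 := by
    intro h0
    apply hgen0
    have h1 : ((PowerSeries.constantCoeff gen : ℤ_[3]) : ℚ_[3]) = 0 := by
      rw [hι0, h0, zero_mul, mul_zero]
    exact PadicInt.coe_eq_zero.mp h1
  have hP := constantCoeff_chromaticL_of_isSprungPair_of_isNewformOf hp2 hf hgood hSP col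
  have hr : ratPlusSymbol f 0 ≠ 0 := by
    intro h0
    apply hL0
    rw [hP, h0, Rat.cast_zero, mul_zero]
  have hpos : 0 < plusPeriod f := IsNewform0.plusPeriod_pos_holds hf.1 hf.coeffField_eq_bot
  rw [hf.entireLFunction_one_eq]
  exact_mod_cast mul_ne_zero (Rat.cast_ne_zero.mpr hr) hpos.ne'

/-! ### Faithfulness edge for the named fact -/

/-- EDGE (faithfulness record for `Sprung2024/ChromaticSmallControl.lean`): the all-conductor form of
Lemma 5.6 specialises to the printed §5.2 form with its standing square-free hypothesis (the binder
`W.IsSemistable (𝓞 ℚ)` is simply not used). [cite: Sprung2024, §5.2 Lemma 5.6 (p. 41)]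
[cite: RaySprung2025, p. 2343] -/
theorem lem56_sharpFlat_finite_coinvariants_of_finite_selmer_of_allN
    (h : lem56AllN_sharpFlat_finite_coinvariants_of_finite_selmer) :
    lem56_sharpFlat_finite_coinvariants_of_finite_selmer := by
  intro W _ _ p _ hp2 _ hgood hap κ γ hκ hγ hX v hv g hg cneg c hH col D hfin
  exact h W p hp2 hgood hap κ γ hκ hγ hX v hv g hg cneg c hH col D hfin

end Summit.BirchSwinnertonDyer.BirchSwinnertonDyer.Theorems.SprungLowerHalfAtThreeSplit

end
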